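import Summits.BirchSwinnertonDyer.BirchSwinnertonDyer.Theorems.PrintCf2RubinValueTwoZetaSpanSignInput
import Literature.NumberTheory.EllipticCurves.ZpExtensionSplitLineProofs
import HarnessLib

/-!
# P4 (I-b) in the CHOSEN-EMBEDDING inertia currency `GreenbergSelmer.inertia u` (bridge to -w2 g19's tame conductor)

Cell `bsd-print-cf2`, width seat `bsd-line-cf2-p1-w3` g19; crux child `MainConjClauseAtSplitTwoQuadDA` (stmt-BirchSwinnertonDyer-24721),
`--supports` helper; Theses-free; THEOREMS ONLY; 0 facts / 0 sorry.

`…ZetaSpanSignInput.exists_mem_pairLayerSubgroup_inf_galFixing_rayClassField_apply_eq_neg_one` (p737790) states the SIGN input (I-b) of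
-w5 g11's (β5) trichotomy under a ramification hypothesis phrased with Mathlib's inertia groups `𝔓.inertia Γ_K` of primes `𝔓` of `\bar ℤ_K`.
The tame conductor of -w2 g19 (`…RowTwoTameConductor.exists_tameConductor_of_sq`, p738228) delivers its last conjunct in the tree's OTHER
currency, the chosen-embedding inertia group `GreenbergSelmer.inertia u = res(I_{K_u})`:
`∀ u ∈ suppPF p 𝔣, p ∉ u → ∃ δ₀ ∈ inertia u, θ′ δ₀ = -1`. This file is the two-line bridge (dictionary
`inertia_adicCompletionPrime_eq_map_absInertia`: `inertia u = I_{𝔓₀}`, `𝔓₀ = adicCompletionPrime K u ∈ u.primesAbove`):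

* `exists_mem_pairLayerSubgroup_inf_galFixing_rayClassField_apply_eq_neg_one_of_inertia` — (I-b) VERBATIM from -w2's conjunct VERBATIM;
* `exists_mem_pairLayerSubgroup_inf_galFixing_rayClassField_apply_eq_neg_one_of_inertia_ne_one` — the same from `θ′² = 1` and
  `∃ δ ∈ inertia u, θ′ δ ≠ 1` (the `≠ 1` form of -w2's `exists_tameConductor`).

HONEST FRAMING: closes nothing by itself; no summit statement is proved by this seat; BSD is not proved by any of this.

## References
* [Washington1997] L. C. Washington, *Introduction to Cyclotomic Fields*, Prop. 13.2.
* [NeukirchANT1999] J. Neukirch, *Algebraic Number Theory*, Ch. II §9 (9.6) (`I_w(L|K) ≅ I(L_w|K_v)`), Ch. VI §6 (6.6).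
-/

-- the summit namespace `Summit.BirchSwinnertonDyer.BirchSwinnertonDyer` repeats the problem name by design (D-0017)
set_option linter.dupNamespace false
set_option autoImplicit false

noncomputable section

open scoped Classical NumberField
open Field IsDedekindDomain IntermediateField NumberField
open Literature.NumberTheory.NumberFields (rayClassField)
open Literature.NumberTheory.GaloisRepresentations Literature.NumberTheory.GaloisRepresentations.LocalWeilDatum
open Literature.NumberTheory.EllipticCurves Literature.NumberTheory.EllipticCurves.GreenbergSelmer
open Literature.NumberTheory.ComplexMultiplication.EllipticUnits
open Literature.NumberTheory.ComplexMultiplication.EllipticUnits.JohnsonLeungKings2011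

namespace Summit.BirchSwinnertonDyer.BirchSwinnertonDyer.Theorems.PrintCf2.ZetaSpanSignInput

variable {K : Type} [Field K] [NumberField K] (p : ℕ) [Fact p.Prime]

/-- ★★ **P4 (I-b) VERBATIM from -w2 g19's tame-conductor conjunct VERBATIM** (`∀ u ∈ supp(p𝔣), p ∉ u → ∃ δ₀ ∈ inertia u, θ′ δ₀ = -1`,
chosen-embedding inertia `GreenbergSelmer.inertia u = I_{𝔓₀}`, `𝔓₀ = adicCompletionPrime K u`): `δ₀` lies in `Gal(K̄/K̃_n)`
(Washington 13.2) and fixes `C_{𝔤₁}` for `u ∤ 𝔤₁ ≠ 0` (`C_{𝔤₁}` unramified at `u`). [cite: Washington1997, Prop. 13.2]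
[cite: NeukirchANT1999, Ch. II §9 Prop. (9.6), Ch. VI §6 Cor. (6.6)] -/
theorem exists_mem_pairLayerSubgroup_inf_galFixing_rayClassField_apply_eq_neg_one_of_inertia
    (κ₁ κ₂ : ZpExtension K p) (θ' : absoluteGaloisGroup K →ₜ* ℤ_[p]ˣ) (𝔣 : Ideal (𝓞 K))
    (hram : ∀ u ∈ JohnsonLeungKings2011.suppPF p 𝔣, ((p : ℕ) : 𝓞 K) ∉ u.asIdeal → ∃ δ₀ ∈ inertia u, θ' δ₀ = -1) :
    ∀ (𝔩 : HeightOneSpectrum (𝓞 K)), 𝔩 ∈ suppPF p 𝔣 → ((p : ℕ) : 𝓞 K) ∉ 𝔩.asIdeal →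
      ∀ (𝔤₁ : Ideal (𝓞 K)) (n : ℕ), 𝔤₁ ≠ ⊥ → ¬ 𝔤₁ ≤ 𝔩.asIdeal →
        ∃ ρ ∈ JohnsonLeungKings2011.pairLayerSubgroup κ₁ κ₂ n ⊓ galFixing K (rayClassField K 𝔤₁), θ' ρ = -1 := by
  intro 𝔩 h𝔩 hp𝔩 𝔤₁ n h𝔤₁ h𝔤₁𝔩
  obtain ⟨δ, hδ, hθ⟩ := hram 𝔩 h𝔩 hp𝔩
  have e : inertia 𝔩 = (adicCompletionPrime K 𝔩).inertia (absoluteGaloisGroup K) :=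
    (inertia_adicCompletionPrime_eq_map_absInertia K 𝔩).symm
  rw [e] at hδ
  exact ⟨δ, ⟨inertia_le_pairLayerSubgroup_of_not_mem p κ₁ κ₂ n hp𝔩 (adicCompletionPrime_mem_primesAbove K 𝔩) hδ,
    inertia_le_galFixing_rayClassField_of_not_le h𝔤₁ h𝔤₁𝔩 (adicCompletionPrime_mem_primesAbove K 𝔩) hδ⟩, hθ⟩

/-- The same from a quadratic `θ′` (`θ′² = 1`) RAMIFIED at the tame support in the chosen-embedding currency
(`∃ δ ∈ inertia u, θ′ δ ≠ 1`, the `≠ 1` form of -w2 g19's `exists_tameConductor`). [cite: Washington1997, Prop. 13.2]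
[cite: NeukirchANT1999, Ch. II §9 Prop. (9.6), Ch. VI §6 Cor. (6.6)] -/
theorem exists_mem_pairLayerSubgroup_inf_galFixing_rayClassField_apply_eq_neg_one_of_inertia_ne_one
    (κ₁ κ₂ : ZpExtension K p) (θ' : absoluteGaloisGroup K →ₜ* ℤ_[p]ˣ) (𝔣 : Ideal (𝓞 K))
    (hθ2 : ∀ σ : absoluteGaloisGroup K, θ' σ ^ 2 = 1)
    (hram : ∀ u ∈ JohnsonLeungKings2011.suppPF p 𝔣, ((p : ℕ) : 𝓞 K) ∉ u.asIdeal → ∃ δ ∈ inertia u, θ' δ ≠ 1) :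
    ∀ (𝔩 : HeightOneSpectrum (𝓞 K)), 𝔩 ∈ suppPF p 𝔣 → ((p : ℕ) : 𝓞 K) ∉ 𝔩.asIdeal →
      ∀ (𝔤₁ : Ideal (𝓞 K)) (n : ℕ), 𝔤₁ ≠ ⊥ → ¬ 𝔤₁ ≤ 𝔩.asIdeal →
        ∃ ρ ∈ JohnsonLeungKings2011.pairLayerSubgroup κ₁ κ₂ n ⊓ galFixing K (rayClassField K 𝔤₁), θ' ρ = -1 :=
  exists_mem_pairLayerSubgroup_inf_galFixing_rayClassField_apply_eq_neg_one_of_inertia p κ₁ κ₂ θ' 𝔣 fun u hu hup ↦ by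
    obtain ⟨δ, hδ, hne⟩ := hram u hu hup
    exact ⟨δ, hδ, units_eq_neg_one_of_sq_eq_one_of_ne_one p (hθ2 δ) hne⟩

end Summit.BirchSwinnertonDyer.BirchSwinnertonDyer.Theorems.PrintCf2.ZetaSpanSignInput

end
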